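import Summits.CriticalPhenomena.PercolationContinuityZ3.Theorems.SahiAEBandGeometry

/-!
# Supports of planar TP₂ densities: a full sublattice of the square is almost an open band

Support file of the Sahi cell (`prim-sahi`, typer seat, generation 24; `--supports stmt-CriticalPhenomena-4575`).
Theorems only (no definitions, no named facts, no sorries).

The measurable form of the double-echelon theorem for `TN₂` matrices without zero lines (Fallat–Johnson, *Totally
nonnegative matrices* (2011), §1.6, Thm. 1.6.4 / Cor. 1.6.5; in the tree as
`Literature.LinearAlgebra.Matrix.IsTN2.isDoubleEchelon`, `….isDoubleEchelon_iff_isSublattice`,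
`Literature/LinearAlgebra/Matrix/DoubleEchelonPattern.lean`): let `L ⊆ (0,1)²` be a measurable honest sublattice (closed under
`∧`, `∨`) which is FULL — almost every vertical and almost every horizontal line of the square meets `L`.  Then `L`
coincides almost everywhere with the OPEN BAND (`Plane.IsBand`)

  `B = {w : x₀ < w₀ < y₀, y₁ < w₁ < x₁ for some x, y ∈ L}`,

the union of the open rectangles spanned by the upper-left/lower-right pairs of `L` (`Plane.exists_isBand_ae_eq`):
* `B` is an open band by pointwise lattice algebra (`isBand_rectUnion`);
* a point of such a rectangle whose vertical and horizontal lines meet `L` lies in `L` (`mem_of_mem_rect`: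
  four meets/joins), so `B ⊆ L` almost everywhere by fullness;
* a point of `L` outside `B` has no point of `L` strictly to its upper left, or none strictly to its lower right;
  both exceptional sets are COMONOTONE (`z₀ < z'₀ ⟹ z₁ ≤ z'₁`) and a measurable comonotone subset of the square is
  Lebesgue-null (`volume_eq_zero_of_comonotone`: its vertical sections lie in the jump intervals of the monotone
  function `u(s) = sup{z₁ : z ∈ E, z₀ ≤ s}`, which is continuous off a countable set).

With `SahiAESublatticeVersion.lean` (an almost sublattice is a.e. an honest one) and the band theorem
(`SahiAEBand.lean`) this is the support step of the planar structure theorem for densities with zeros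
(`SahiAEPlaneZeros.lean`).  No sorries, no new axioms.
-/

noncomputable section

namespace Summit.CriticalPhenomena.PercolationContinuityZ3.Theorems.SahiAEFourFunctions

namespace Plane

open MeasureTheory Set Filter Topology Function
open scoped ENNReal NNReal

/-! ### Comonotone sets are null -/

/-- Vertical sections of a planar set, through the identification `ℝ² ≃ ℝ × ℝ`. [folklore] -/
theorem volume_eq_lintegral_sections {E : Set (Fin 2 → ℝ)} (hE : MeasurableSet E) :
    volume E = ∫⁻ s, volume {t : ℝ | (![s, t] : Fin 2 → ℝ) ∈ E} := by
  have hmp := MeasureTheory.volume_preserving_finTwoArrow ℝ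
  have hE' : MeasurableSet ((MeasurableEquiv.finTwoArrow (α := ℝ)).symm ⁻¹' E) :=
    (MeasurableEquiv.finTwoArrow (α := ℝ)).symm.measurable hE
  have h1 : volume E = volume ((MeasurableEquiv.finTwoArrow (α := ℝ)).symm ⁻¹' E) := by
    rw [← hmp.measure_preimage hE'.nullMeasurableSet, ← Set.preimage_comp, MeasurableEquiv.symm_comp_self,
      Set.preimage_id]
  rw [h1, show (volume : Measure (ℝ × ℝ)) = (volume : Measure ℝ).prod volume from rfl, Measure.prod_apply hE']
  rfl

/-- **A measurable comonotone subset of the square is Lebesgue-null.**  Comonotone: `z₀ < z'₀ ⟹ z₁ ≤ z'₁` for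
`z, z' ∈ E`.  (The section of `E` at abscissa `s` lies in the jump interval `[u(s−), u(s)]` of the monotone
`u(s) = sup{z₁ : z ∈ E, z₀ ≤ s}`, which has only countably many jumps.) [this work] -/
theorem volume_eq_zero_of_comonotone {E : Set (Fin 2 → ℝ)} (hE : MeasurableSet E)
    (hpos : ∀ z ∈ E, 0 < z 1) (hle1 : ∀ z ∈ E, z 1 ≤ 1)
    (hco : ∀ z ∈ E, ∀ z' ∈ E, z 0 < z' 0 → z 1 ≤ z' 1) : volume E = 0 := by
  set A : ℝ → Set ℝ := fun s => insert 0 {t | ∃ z ∈ E, z 0 ≤ s ∧ z 1 = t} with hA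
  have hAne : ∀ s, (A s).Nonempty := fun s => ⟨0, mem_insert _ _⟩
  have hAbd : ∀ s, BddAbove (A s) := fun s => ⟨1, by
    rintro t (rfl | ⟨z, hz, -, rfl⟩)
    · exact zero_le_one
    · exact hle1 z hz⟩
  set u : ℝ → ℝ := fun s => sSup (A s) with hu
  have humono : Monotone u := fun s s' hss' =>
    csSup_le_csSup (hAbd s') (hAne s) (insert_subset_insert fun t ⟨z, hz, hzs, hzt⟩ => ⟨z, hz, hzs.trans hss', hzt⟩)
  have key1 : ∀ z ∈ E, z 1 ≤ u (z 0) := fun z hz =>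
    le_csSup (hAbd _) (mem_insert_of_mem _ ⟨z, hz, le_rfl, rfl⟩)
  have key2 : ∀ z ∈ E, ∀ s', s' < z 0 → u s' ≤ z 1 := fun z hz s' hs' => by
    refine csSup_le (hAne _) ?_
    rintro t (rfl | ⟨z', hz', hz's, rfl⟩)
    · exact (hpos z hz).le
    · exact hco z' hz' z hz (lt_of_le_of_lt hz's hs')
  have key3 : ∀ z ∈ E, Function.leftLim u (z 0) ≤ z 1 := fun z hz => by
    rw [humono.leftLim_eq_sSup]
    refine csSup_le ((Set.nonempty_Iio).image u) ?_
    rintro _ ⟨s', hs', rfl⟩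
    exact key2 z hz s' hs'
  -- off the countable set of discontinuities the sections are subsingletons
  set D : Set ℝ := {s | ¬ContinuousAt u s} with hD
  have hDc : D.Countable := humono.countable_not_continuousAt
  have hsec : ∀ s, s ∉ D → volume {t : ℝ | (![s, t] : Fin 2 → ℝ) ∈ E} = 0 := by
    intro s hs
    have hcont : ContinuousAt u s := not_not.1 hs
    have hll : Function.leftLim u s = u s := (humono.continuousWithinAt_Iio_iff_leftLim_eq).1 hcont.continuousWithinAt
    have hsub : {t : ℝ | (![s, t] : Fin 2 → ℝ) ∈ E} ⊆ {u s} := fun t ht => by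
      have h1 := key1 _ ht
      have h3 := key3 _ ht
      simp only [Matrix.cons_val_zero, Matrix.cons_val_one] at h1 h3
      rw [hll] at h3
      exact le_antisymm h1 h3
    exact measure_mono_null hsub (measure_singleton _)
  have hae : ∀ᵐ s ∂(volume : Measure ℝ), volume {t : ℝ | (![s, t] : Fin 2 → ℝ) ∈ E} = 0 := by
    filter_upwards [(measure_eq_zero_iff_ae_notMem.1 (hDc.measure_zero volume))] with s hs using hsec s hs
  rw [volume_eq_lintegral_sections hE, lintegral_congr_ae hae, lintegral_zero]

/-! ### The open band spanned by a sublattice -/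

/-- **Points of the spanned rectangles with both lines through `L` lie in `L`** (four meets and joins).  Here `x` is
upper left of `y` (`x₀ ≤ y₀`, `y₁ ≤ x₁`), `w` lies in the closed rectangle they span, and the vertical and the
horizontal line through `w` both meet `L`. [this work] -/
theorem mem_of_mem_rect {L : Set (Fin 2 → ℝ)} (hinf : ∀ x ∈ L, ∀ y ∈ L, x ⊓ y ∈ L)
    (hsup : ∀ x ∈ L, ∀ y ∈ L, x ⊔ y ∈ L) {x y w v h : Fin 2 → ℝ} (hx : x ∈ L) (hy : y ∈ L) (hv : v ∈ L)
    (hh : h ∈ L) (hv0 : v 0 = w 0) (hh1 : h 1 = w 1) (h0 : x 0 ≤ w 0) (h0' : w 0 ≤ y 0) (h1 : y 1 ≤ w 1)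
    (h1' : w 1 ≤ x 1) : w ∈ L := by
  -- the points `a = (w₀, y₁)` and `b = (w₀, x₁)` of the vertical line through `w`
  have ha : update w 1 (y 1) ∈ L := by
    rcases le_total (v 1) (y 1) with hv1 | hv1
    · have e : v ⊔ (x ⊓ y) = update w 1 (y 1) := by
        funext k; fin_cases k
        · simp [hv0, min_eq_left (h0.trans h0'), max_eq_left h0]
        · simp [min_eq_right (h1.trans h1'), max_eq_right hv1]
      rw [← e]; exact hsup _ hv _ (hinf _ hx _ hy)
    · have e : v ⊓ y = update w 1 (y 1) := by
        funext k; fin_cases k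
        · simp [hv0, min_eq_left h0']
        · simp [min_eq_right hv1]
      rw [← e]; exact hinf _ hv _ hy
  have hb : update w 1 (x 1) ∈ L := by
    rcases le_total (v 1) (x 1) with hv1 | hv1
    · have e : v ⊔ x = update w 1 (x 1) := by
        funext k; fin_cases k
        · simp [hv0, max_eq_left h0]
        · simp [max_eq_right hv1]
      rw [← e]; exact hsup _ hv _ hx
    · have e : v ⊓ (x ⊔ y) = update w 1 (x 1) := by
        funext k; fin_cases k
        · simp [hv0, max_eq_right (h0.trans h0'), min_eq_left h0']
        · simp [max_eq_left (h1.trans h1'), min_eq_right hv1]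
      rw [← e]; exact hinf _ hv _ (hsup _ hx _ hy)
  rcases le_total (h 0) (w 0) with hh0 | hh0
  · have e : h ⊔ update w 1 (y 1) = w := by
      funext k; fin_cases k
      · simp [max_eq_right hh0]
      · simp [hh1, max_eq_left h1]
    rw [← e]; exact hsup _ hh _ ha
  · have e : h ⊓ update w 1 (x 1) = w := by
      funext k; fin_cases k
      · simp [min_eq_right hh0]
      · simp [hh1, min_eq_left h1']
    rw [← e]; exact hinf _ hh _ hb

/-- **The union of the open rectangles spanned by a sublattice is an open band.** [this work] -/
theorem isBand_rectUnion {L : Set (Fin 2 → ℝ)} (hinf : ∀ x ∈ L, ∀ y ∈ L, x ⊓ y ∈ L)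
    (hsup : ∀ x ∈ L, ∀ y ∈ L, x ⊔ y ∈ L) :
    IsBand {w : Fin 2 → ℝ | ∃ x ∈ L, ∃ y ∈ L, x 0 < w 0 ∧ w 0 < y 0 ∧ y 1 < w 1 ∧ w 1 < x 1} := by
  refine ⟨?_, ?_, ?_, ?_⟩
  · have e : {w : Fin 2 → ℝ | ∃ x ∈ L, ∃ y ∈ L, x 0 < w 0 ∧ w 0 < y 0 ∧ y 1 < w 1 ∧ w 1 < x 1} =
        ⋃ x ∈ L, ⋃ y ∈ L, {w : Fin 2 → ℝ | x 0 < w 0 ∧ w 0 < y 0 ∧ y 1 < w 1 ∧ w 1 < x 1} := by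
      ext w; simp only [Set.mem_setOf_eq, Set.mem_iUnion, exists_prop]
    rw [e]
    refine isOpen_biUnion fun x _ => isOpen_biUnion fun y _ => ?_
    have c0 : Continuous fun w : Fin 2 → ℝ => w 0 := continuous_apply 0
    have c1 : Continuous fun w : Fin 2 → ℝ => w 1 := continuous_apply 1
    have e2 : {w : Fin 2 → ℝ | x 0 < w 0 ∧ w 0 < y 0 ∧ y 1 < w 1 ∧ w 1 < x 1} =
        ({w | x 0 < w 0} ∩ {w | w 0 < y 0}) ∩ ({w | y 1 < w 1} ∩ {w | w 1 < x 1}) := by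
      ext w; simp only [Set.mem_inter_iff, Set.mem_setOf_eq, and_assoc]
    rw [e2]
    exact ((isOpen_lt continuous_const c0).inter (isOpen_lt c0 continuous_const)).inter
      ((isOpen_lt continuous_const c1).inter (isOpen_lt c1 continuous_const))
  · rintro w ⟨x, hx, y, hy, h1, h2, h3, h4⟩ w' ⟨x', hx', y', hy', h1', h2', h3', h4'⟩
    refine ⟨x ⊓ x', hinf _ hx _ hx', y ⊓ y', hinf _ hy _ hy', ?_, ?_, ?_, ?_⟩ <;>
      simp only [Pi.inf_apply]
    · exact min_lt_min h1 h1'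
    · exact min_lt_min h2 h2'
    · exact min_lt_min h3 h3'
    · exact min_lt_min h4 h4'
  · rintro w ⟨x, hx, y, hy, h1, h2, h3, h4⟩ w' ⟨x', hx', y', hy', h1', h2', h3', h4'⟩
    refine ⟨x ⊔ x', hsup _ hx _ hx', y ⊔ y', hsup _ hy _ hy', ?_, ?_, ?_, ?_⟩ <;>
      simp only [Pi.sup_apply]
    · exact max_lt_max h1 h1'
    · exact max_lt_max h2 h2'
    · exact max_lt_max h3 h3'
    · exact max_lt_max h4 h4'
  · rintro w ⟨x, hx, y, hy, h1, h2, h3, h4⟩ w' ⟨x', hx', y', hy', h1', h2', h3', h4'⟩ hww' hor z hz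
    rcases hor with e0 | e1
    · -- vertical segment: the pair `(x', y)` spans a rectangle containing it
      have hz0 : z 0 = w 0 := le_antisymm (by rw [e0]; exact hz.2 0) (hz.1 0)
      refine ⟨x', hx', y, hy, ?_, ?_, ?_, ?_⟩
      · rw [hz0, e0]; exact h1'
      · rw [hz0]; exact h2
      · exact h3.trans_le (hz.1 1)
      · exact (hz.2 1).trans_lt h4'
    · -- horizontal segment: the pair `(x, y')`
      have hz1 : z 1 = w 1 := le_antisymm (by rw [e1]; exact hz.2 1) (hz.1 1)
      refine ⟨x, hx, y', hy', ?_, ?_, ?_, ?_⟩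
      · exact h1.trans_le (hz.1 0)
      · exact (hz.2 0).trans_lt h2'
      · rw [hz1, e1]; exact h3'
      · rw [hz1]; exact h4

/-- The two exceptional sets are measurable: `L` minus an open set. [folklore] -/
theorem measurableSet_noUpperLeft {L : Set (Fin 2 → ℝ)} (hLm : MeasurableSet L) :
    MeasurableSet {z ∈ L | ¬∃ x ∈ L, x 0 < z 0 ∧ z 1 < x 1} := by
  have hopen : IsOpen {z : Fin 2 → ℝ | ∃ x ∈ L, x 0 < z 0 ∧ z 1 < x 1} := by
    have e : {z : Fin 2 → ℝ | ∃ x ∈ L, x 0 < z 0 ∧ z 1 < x 1} = ⋃ x ∈ L, {z | x 0 < z 0 ∧ z 1 < x 1} := by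
      ext z; simp only [Set.mem_setOf_eq, Set.mem_iUnion, exists_prop]
    rw [e]
    exact isOpen_biUnion fun x _ =>
      (isOpen_lt continuous_const (continuous_apply 0)).inter (isOpen_lt (continuous_apply 1) continuous_const)
  exact hLm.inter hopen.measurableSet.compl

/-- The lower-right exceptional set is measurable. [folklore] -/
theorem measurableSet_noLowerRight {L : Set (Fin 2 → ℝ)} (hLm : MeasurableSet L) :
    MeasurableSet {z ∈ L | ¬∃ y ∈ L, z 0 < y 0 ∧ y 1 < z 1} := by
  have hopen : IsOpen {z : Fin 2 → ℝ | ∃ y ∈ L, z 0 < y 0 ∧ y 1 < z 1} := by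
    have e : {z : Fin 2 → ℝ | ∃ y ∈ L, z 0 < y 0 ∧ y 1 < z 1} = ⋃ y ∈ L, {z | z 0 < y 0 ∧ y 1 < z 1} := by
      ext z; simp only [Set.mem_setOf_eq, Set.mem_iUnion, exists_prop]
    rw [e]
    exact isOpen_biUnion fun y _ =>
      (isOpen_lt (continuous_apply 0) continuous_const).inter (isOpen_lt continuous_const (continuous_apply 1))
  exact hLm.inter hopen.measurableSet.compl

/-- **A full measurable sublattice of the open unit square is almost everywhere an open band.**  Fullness: almost
every vertical and almost every horizontal line of the square meets `L`. [this work] -/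
theorem exists_isBand_ae_eq {L : Set (Fin 2 → ℝ)} (hLm : MeasurableSet L)
    (hLU : L ⊆ Set.pi univ fun _ => Ioo (0 : ℝ) 1)
    (hinf : ∀ x ∈ L, ∀ y ∈ L, x ⊓ y ∈ L) (hsup : ∀ x ∈ L, ∀ y ∈ L, x ⊔ y ∈ L)
    (h0 : ∀ᵐ s ∂(volume : Measure ℝ), s ∈ Ioo (0 : ℝ) 1 → ∃ z ∈ L, z 0 = s)
    (h1 : ∀ᵐ t ∂(volume : Measure ℝ), t ∈ Ioo (0 : ℝ) 1 → ∃ z ∈ L, z 1 = t) :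
    ∃ B : Set (Fin 2 → ℝ), IsBand B ∧ B ⊆ Set.pi univ (fun _ => Ioo (0 : ℝ) 1) ∧ B =ᵐ[volume] L := by
  set B : Set (Fin 2 → ℝ) := {w | ∃ x ∈ L, ∃ y ∈ L, x 0 < w 0 ∧ w 0 < y 0 ∧ y 1 < w 1 ∧ w 1 < x 1} with hB
  have hBU : B ⊆ Set.pi univ (fun _ => Ioo (0 : ℝ) 1) := by
    rintro w ⟨x, hx, y, hy, a1, a2, a3, a4⟩
    have hxU := Set.mem_univ_pi.1 (hLU hx)
    have hyU := Set.mem_univ_pi.1 (hLU hy)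
    refine Set.mem_univ_pi.2 fun k => ?_
    fin_cases k
    · exact ⟨(hxU 0).1.trans a1, a2.trans (hyU 0).2⟩
    · exact ⟨(hyU 1).1.trans a3, a4.trans (hxU 1).2⟩
  refine ⟨B, isBand_rectUnion hinf hsup, hBU, ?_⟩
  -- `B ⊆ L` almost everywhere: fullness and the four meets/joins
  have hBL : ∀ᵐ w ∂(volume : Measure (Fin 2 → ℝ)), w ∈ B → w ∈ L := by
    filter_upwards [ae_coord_of_ae 0 h0, ae_coord_of_ae 1 h1] with w hw0 hw1 hwB
    obtain ⟨x, hx, y, hy, a1, a2, a3, a4⟩ := hwB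
    have hwU := Set.mem_univ_pi.1 (hBU ⟨x, hx, y, hy, a1, a2, a3, a4⟩)
    obtain ⟨v, hv, hv0⟩ := hw0 (hwU 0)
    obtain ⟨h, hh, hh1⟩ := hw1 (hwU 1)
    exact mem_of_mem_rect hinf hsup hx hy hv hh hv0 hh1 a1.le a2.le a3.le a4.le
  -- `L ⊆ B` almost everywhere: the two comonotone exceptional sets
  have hUL : volume {z ∈ L | ¬∃ x ∈ L, x 0 < z 0 ∧ z 1 < x 1} = 0 := by
    refine volume_eq_zero_of_comonotone (measurableSet_noUpperLeft hLm)
      (fun z hz => (Set.mem_univ_pi.1 (hLU hz.1) 1).1) (fun z hz => (Set.mem_univ_pi.1 (hLU hz.1) 1).2.le)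
      fun z hz z' hz' hzz' => ?_
    by_contra hcon
    exact hz'.2 ⟨z, hz.1, hzz', not_le.1 hcon⟩
  have hLR : volume {z ∈ L | ¬∃ y ∈ L, z 0 < y 0 ∧ y 1 < z 1} = 0 := by
    refine volume_eq_zero_of_comonotone (measurableSet_noLowerRight hLm)
      (fun z hz => (Set.mem_univ_pi.1 (hLU hz.1) 1).1) (fun z hz => (Set.mem_univ_pi.1 (hLU hz.1) 1).2.le)
      fun z hz z' hz' hzz' => ?_
    by_contra hcon
    exact hz.2 ⟨z', hz'.1, hzz', not_le.1 hcon⟩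
  have hLB : ∀ᵐ z ∂(volume : Measure (Fin 2 → ℝ)), z ∈ L → z ∈ B := by
    have a1 := (measure_eq_zero_iff_ae_notMem.1 hUL)
    have a2 := (measure_eq_zero_iff_ae_notMem.1 hLR)
    filter_upwards [a1, a2] with z hz1 hz2 hzL
    simp only [not_and, not_not] at hz1 hz2
    obtain ⟨x, hx, hx0, hx1⟩ := hz1 hzL
    obtain ⟨y, hy, hy0, hy1⟩ := hz2 hzL
    exact ⟨x, hx, y, hy, hx0, hy0, hy1, hx1⟩
  refine (ae_eq_set).2 ⟨?_, ?_⟩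
  · exact measure_eq_zero_iff_ae_notMem.2 (by filter_upwards [hBL] with w hw h; exact h.2 (hw h.1))
  · exact measure_eq_zero_iff_ae_notMem.2 (by filter_upwards [hLB] with w hw h; exact h.2 (hw h.1))

end Plane

end Summit.CriticalPhenomena.PercolationContinuityZ3.Theorems.SahiAEFourFunctions
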